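import Mathlib
import HarnessLib

/-!
# The Gaussian model of the Metropolis acceptance rate: `⟨min(1, e^{−Δ})⟩ = erfc(√(Σ²/8))`

Topic `Probability/Distributions`.  PUBLISHED RESULT with our formalisation of the printed
computation; no named fact is introduced.

Source: F. Knechtli, U. Wolff, *Dynamical fermions as a global correction*, Nucl. Phys. B 663
(2003) 3, §3, eqs. (3.12)–(3.13).  In a global Metropolis correction step with action difference
`Δ = E' − E`, modelling the action as Gaussian over the proposals forces ("one sees that q is
independent of `E₀` as it should") the law of `Δ` to be the Gaussian
"`ν̃(Δ) = (2√π Σ)⁻¹ exp(−(Δ − Σ²)²/(4Σ²))`" (3.12) — mean `Σ²`, variance `2Σ²`, i.e. MEAN = HALF THE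
VARIANCE, the only Gaussian compatible with `⟨e^{−Δ}⟩ = 1` — and then the acceptance rate is
"`q = ∫ dΔ ν̃(Δ) min(1, exp(−Δ)) = (2/√π) ∫_{Σ/2}^{∞} du exp(−u²) = erfc(Σ/2)`" (3.13).
Writing `w = 2Σ²` for the variance this is `erfc(√(w/8))`, the form used for every filter of the
hierarchical algorithm of Finkenrath–Knechtli–Leder, CPC 184 (2013) 1522, §2:
"`⟨P_acc^{(i)}⟩ = erfc(√(Σᵢ²/8))`, computed assuming a Gaussian distribution for `Δᵢ(s,s')` with
variance `Σᵢ²`", whence "the acceptance rate decreases exponentially with the volume" when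
`Σ² ∝ V` (their §2); the same formula with `w = Var(ΔH)` is the standard Hybrid-Monte-Carlo
acceptance estimate `erfc(½√⟨ΔH⟩)` (`⟨ΔH⟩ = w/2`).

Lean reading: `Δ ∼ gaussianReal (w/2) w` (Mathlib: mean, variance `w : ℝ≥0`, `w ≠ 0`);
`erfc z = (2/√π) ∫_{u > z} e^{−u²} du` is written out (DLMF 7.2.2), no new definition.

Contents (all proved):
* `integral_exp_neg_gaussianReal` — `⟨e^{−Δ}⟩ = 1` for `Δ ∼ N(w/2, w)` (the consistency condition
  behind (3.9)–(3.12); from Mathlib's Gaussian mgf);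
* `integral_min_one_exp_neg_gaussianReal` — `⟨min(1, e^{−Δ})⟩ = 2·P(Δ ≤ 0)` for `Δ ∼ N(w/2, w)`
  (the exponential tilt of `N(w/2, w)` restricted to `Δ > 0` is `N(−w/2, w)`, the mirror image);
* `gaussianReal_half_Iic_zero` — `2·P(Δ ≤ 0) = (2/√π) ∫_{u > √(w/8)} e^{−u²} du`
  (standardisation and the substitution `u = x/√2`);
* `integral_min_one_exp_neg_gaussianReal_eq_erfc` — KW (3.13) / FKL (acceptance):
  `⟨min(1, e^{−Δ})⟩ = (2/√π) ∫_{u > √(w/8)} e^{−u²} du  (= erfc(√(w/8)) = erfc(Σ/2), w = 2Σ²)`.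
-/

namespace Literature.Probability.Distributions

open MeasureTheory ProbabilityTheory Set
open scoped NNReal ENNReal

/-- The exponential tilt of the Gaussian density with mean = half the variance is its mirror image:
`e^{−x} φ_{w/2, w}(x) = φ_{−w/2, w}(x)` (completing the square; private helper). [folklore] -/
private theorem exp_neg_mul_gaussianPDFReal {w : ℝ≥0} (hw : w ≠ 0) (x : ℝ) :
    Real.exp (-x) * gaussianPDFReal ((w : ℝ) / 2) w x = gaussianPDFReal (-((w : ℝ) / 2)) w x := by
  simp only [gaussianPDFReal_def]
  rw [mul_left_comm, ← Real.exp_add]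
  congr 2
  have hw' : (w : ℝ) ≠ 0 := NNReal.coe_ne_zero.mpr hw
  field_simp
  ring

/-- For a non-degenerate Gaussian, `(N s).toReal = ∫_s φ` (private helper). [folklore] -/
private theorem toReal_gaussianReal_apply (m : ℝ) {w : ℝ≥0} (hw : w ≠ 0) {s : Set ℝ}
    (hs : MeasurableSet s) :
    (gaussianReal m w s).toReal = ∫ x in s, gaussianPDFReal m w x := by
  rw [gaussianReal_apply_eq_integral m hw s,
    ENNReal.toReal_ofReal (setIntegral_nonneg hs fun x _ => gaussianPDFReal_nonneg m w x)]

/-- **`⟨e^{−Δ}⟩ = 1` for `Δ ∼ N(w/2, w)`** — the Gaussian with mean equal to half its variance is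
exactly the one compatible with the exactness identity `⟨e^{−Δ}⟩ = 1` (Knechtli–Wolff's
normalisation `Z` (3.11) of the tilted Gaussian (3.10), which produces the mean `Σ²` = half the
variance `2Σ²` in (3.12)). [cite: KnechtliWolff2003, §3 eqs. (3.10)–(3.12)] -/
theorem integral_exp_neg_gaussianReal (w : ℝ≥0) :
    ∫ x, Real.exp (-x) ∂(gaussianReal ((w : ℝ) / 2) w) = 1 := by
  have h := congrFun (mgf_id_gaussianReal (μ := (w : ℝ) / 2) (v := w)) (-1)
  simp only [mgf, id_eq, neg_one_mul] at h
  rw [h, show (w : ℝ) / 2 * -1 + (w : ℝ) * (-1) ^ 2 / 2 = 0 by ring, Real.exp_zero]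

/-- **The Gaussian acceptance model, probabilistic form**: for `Δ ∼ N(w/2, w)` (`w ≠ 0`),
`⟨min(1, e^{−Δ})⟩ = 2·P(Δ ≤ 0)`.  Proof as in Knechtli–Wolff (3.9)/(3.13): split at `Δ = 0`; on
`Δ > 0` the weight `e^{−Δ}` tilts `N(w/2, w)` into its mirror image `N(−w/2, w)`, whose mass on
`(0, ∞)` equals `P(Δ < 0) = P(Δ ≤ 0)`. [cite: KnechtliWolff2003, §3 eqs. (3.9), (3.12)–(3.13)] -/
theorem integral_min_one_exp_neg_gaussianReal {w : ℝ≥0} (hw : w ≠ 0) :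
    ∫ x, min 1 (Real.exp (-x)) ∂(gaussianReal ((w : ℝ) / 2) w) =
      2 * (gaussianReal ((w : ℝ) / 2) w (Iic 0)).toReal := by
  set m : ℝ := (w : ℝ) / 2 with hm
  rw [integral_gaussianReal_eq_integral_smul hw]
  simp only [smul_eq_mul]
  have hf_int : Integrable (fun x => gaussianPDFReal m w x * min 1 (Real.exp (-x))) := by
    refine (integrable_gaussianPDFReal m w).mono' ?_ (ae_of_all _ fun x => ?_)
    · exact ((measurable_gaussianPDFReal m w).mul
        (measurable_const.min (Real.measurable_exp.comp measurable_neg))).aestronglyMeasurable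
    · rw [Real.norm_eq_abs, abs_of_nonneg (mul_nonneg (gaussianPDFReal_nonneg _ _ _)
        (le_min zero_le_one (Real.exp_pos _).le))]
      exact mul_le_of_le_one_right (gaussianPDFReal_nonneg _ _ _) (min_le_left _ _)
  rw [← integral_add_compl (measurableSet_Iic (a := (0 : ℝ))) hf_int]
  -- piece `Δ ≤ 0`: the integrand is the density itself
  have h1 : ∫ x in Iic (0 : ℝ), gaussianPDFReal m w x * min 1 (Real.exp (-x)) =
      (gaussianReal m w (Iic 0)).toReal := by
    rw [toReal_gaussianReal_apply m hw measurableSet_Iic]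
    refine setIntegral_congr_fun measurableSet_Iic fun x hx => ?_
    rw [min_eq_left (Real.one_le_exp (neg_nonneg.mpr hx)), mul_one]
  -- piece `Δ > 0`: the tilted density is the mirror-image Gaussian
  have h2 : ∫ x in (Iic (0 : ℝ))ᶜ, gaussianPDFReal m w x * min 1 (Real.exp (-x)) =
      (gaussianReal (-m) w (Ioi 0)).toReal := by
    rw [toReal_gaussianReal_apply (-m) hw measurableSet_Ioi, compl_Iic]
    refine setIntegral_congr_fun measurableSet_Ioi fun x hx => ?_
    rw [min_eq_right (Real.exp_le_one_iff.mpr (neg_nonpos.mpr (le_of_lt hx))), mul_comm, hm,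
      exp_neg_mul_gaussianPDFReal hw x]
  -- the mirror image: `N(−m, w)(0, ∞) = N(m, w)(−∞, 0) = N(m, w)(−∞, 0]`
  have h3 : gaussianReal (-m) w (Ioi 0) = gaussianReal m w (Iic 0) := by
    haveI := nullSingletonClass_gaussianReal (μ := m) hw
    rw [← gaussianReal_map_neg, Measure.map_apply measurable_neg measurableSet_Ioi,
      show (fun x : ℝ => -x) ⁻¹' Ioi 0 = Iio 0 by ext x; simp, measure_congr Iio_ae_eq_Iic]
  rw [h1, h2, h3, two_mul]

/-- **Standardisation**: for `Δ ∼ N(w/2, w)` (`w ≠ 0`),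
`2·P(Δ ≤ 0) = (2/√π) ∫_{u > √(w/8)} e^{−u²} du` — i.e. `erfc(√(w/8))` (DLMF 7.2.2), Knechtli–Wolff's
`erfc(Σ/2)` with `w = 2Σ²` (substitution `u = x/√2` in the standard normal tail beyond
`(w/2)/√w = √w/2`). [cite: KnechtliWolff2003, §3 eq. (3.13) (the middle expression
"(2/√π)∫_{Σ/2}^∞ du exp(−u²)")] -/
theorem gaussianReal_half_Iic_zero {w : ℝ≥0} (hw : w ≠ 0) :
    2 * (gaussianReal ((w : ℝ) / 2) w (Iic 0)).toReal =
      2 / Real.sqrt Real.pi * ∫ u in Ioi (Real.sqrt ((w : ℝ) / 8)), Real.exp (-u ^ 2) := by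
  have hw0 : (0 : ℝ) < w := by exact_mod_cast pos_iff_ne_zero.mpr hw
  have hsw : 0 < Real.sqrt (w : ℝ) := Real.sqrt_pos.mpr hw0
  set m : ℝ := (w : ℝ) / 2 with hm
  set a : ℝ := Real.sqrt (w : ℝ) / 2 with ha
  -- Step 1: `N(m, w) = (N(0,1)).map (x ↦ √w·x) .map (· + m)`, so `N(m,w)(Iic 0) = N(0,1)(Iic (−a))`.
  have hstd : gaussianReal m w (Iic 0) = gaussianReal 0 1 (Iic (-a)) := by
    have h1 : gaussianReal m w = (gaussianReal 0 w).map (· + m) := by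
      rw [gaussianReal_map_add_const, zero_add]
    have h2 : gaussianReal 0 w = (gaussianReal 0 1).map (Real.sqrt (w : ℝ) * ·) := by
      rw [gaussianReal_map_const_mul, mul_zero]
      congr 1
      apply NNReal.eq
      simp [Real.sq_sqrt hw0.le]
    rw [h1, Measure.map_apply (measurable_add_const m) measurableSet_Iic, preimage_add_const_Iic,
      h2, Measure.map_apply (measurable_const_mul _) measurableSet_Iic,
      preimage_const_mul_Iic₀ _ hsw]
    have hww : Real.sqrt (w : ℝ) * Real.sqrt (w : ℝ) = w := Real.mul_self_sqrt hw0.le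
    congr 2
    rw [ha, hm, zero_sub, div_eq_iff hsw.ne', neg_mul, div_mul_eq_mul_div, hww]
  -- Step 2: symmetry of `N(0,1)`: `N(0,1)(Iic (−a)) = N(0,1)(Ioi a)`.
  have hsymm : gaussianReal 0 1 (Iic (-a)) = gaussianReal 0 1 (Ioi a) := by
    have hneg : (gaussianReal 0 1).map (fun x : ℝ => -x) = gaussianReal 0 1 := by
      rw [gaussianReal_map_neg, neg_zero]
    haveI := nullSingletonClass_gaussianReal (μ := (0 : ℝ)) one_ne_zero
    conv_lhs => rw [← hneg]
    rw [Measure.map_apply measurable_neg measurableSet_Iic,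
      show (fun x : ℝ => -x) ⁻¹' Iic (-a) = Ici a by ext x; simp,
      measure_congr Ioi_ae_eq_Ici.symm]
  -- Step 3: density of `N(0,1)` on `(a, ∞)` and the substitution `x = √2·u`.
  have htail : (gaussianReal 0 1 (Ioi a)).toReal =
      1 / Real.sqrt Real.pi * ∫ u in Ioi (Real.sqrt ((w : ℝ) / 8)), Real.exp (-u ^ 2) := by
    rw [toReal_gaussianReal_apply 0 one_ne_zero measurableSet_Ioi]
    have hs2 : (0 : ℝ) < Real.sqrt 2 := Real.sqrt_pos.mpr two_pos
    have hsub := integral_comp_mul_left_Ioi (fun x => gaussianPDFReal 0 1 x)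
      (Real.sqrt ((w : ℝ) / 8)) hs2
    -- `√2 · √(w/8) = √w/2 = a`
    have hprod : Real.sqrt 2 * Real.sqrt ((w : ℝ) / 8) = a := by
      rw [ha, ← Real.sqrt_mul zero_le_two, show (2 : ℝ) * ((w : ℝ) / 8) = (w : ℝ) / 4 by ring,
        Real.sqrt_div' _ (by norm_num : (0:ℝ) ≤ 4), show (4 : ℝ) = 2 ^ 2 by norm_num,
        Real.sqrt_sq zero_le_two]
    rw [hprod] at hsub
    -- `hsub : ∫ u in Ioi √(w/8), φ₀₁(√2 u) du = (√2)⁻¹ • ∫ x in Ioi a, φ₀₁ x dx`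
    have hphi : ∀ u : ℝ, gaussianPDFReal 0 1 (Real.sqrt 2 * u) =
        (Real.sqrt (2 * Real.pi))⁻¹ * Real.exp (-u ^ 2) := by
      intro u
      simp only [gaussianPDFReal_def, NNReal.coe_one, mul_one, sub_zero]
      congr 2
      rw [mul_pow, Real.sq_sqrt zero_le_two]
      ring
    simp_rw [hphi, integral_const_mul, smul_eq_mul] at hsub
    have key : ∫ x in Ioi a, gaussianPDFReal 0 1 x =
        Real.sqrt 2 * ((Real.sqrt (2 * Real.pi))⁻¹ *
          ∫ u in Ioi (Real.sqrt ((w : ℝ) / 8)), Real.exp (-u ^ 2)) := by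
      rw [hsub, ← mul_assoc, mul_inv_cancel₀ hs2.ne', one_mul]
    rw [key, Real.sqrt_mul zero_le_two, mul_inv, ← mul_assoc, ← mul_assoc,
      mul_inv_cancel₀ hs2.ne', one_mul, one_div]
  rw [hstd, hsymm, htail]
  ring

/-- **Knechtli–Wolff (3.13) / Finkenrath–Knechtli–Leder's acceptance formula**: if the action
difference of a Metropolis correction step is Gaussian with variance `w` and (necessarily) mean
`w/2`, its average acceptance is
`q = ⟨min(1, e^{−Δ})⟩ = (2/√π) ∫_{√(w/8)}^{∞} e^{−u²} du = erfc(√(w/8))` (`= erfc(Σ/2)` for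
`w = 2Σ²`; `= erfc(½√⟨ΔH⟩)` for HMC with `⟨ΔH⟩ = w/2`).
[cite: KnechtliWolff2003, §3 eq. (3.13)]; [cite: FinkenrathKnechtliLeder2013, §2 (the display
"⟨P_acc^{(i)}⟩ = erfc(√(Σᵢ²/8))")] -/
theorem integral_min_one_exp_neg_gaussianReal_eq_erfc {w : ℝ≥0} (hw : w ≠ 0) :
    ∫ x, min 1 (Real.exp (-x)) ∂(gaussianReal ((w : ℝ) / 2) w) =
      2 / Real.sqrt Real.pi * ∫ u in Ioi (Real.sqrt ((w : ℝ) / 8)), Real.exp (-u ^ 2) := by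
  rw [integral_min_one_exp_neg_gaussianReal hw, gaussianReal_half_Iic_zero hw]

end Literature.Probability.Distributions
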